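import Mathlib
import HarnessLib
import Literature.Analysis.Convex.PhiContractions

/-!
# Data dependence of fixed points; sequences of operators and their fixed points

Source: V. Berinde, *Iterative Approximation of Fixed Points*, 2nd ed., Lecture Notes in
Mathematics 1912, Springer (2007) [Berinde2007], Chapter 7, §7.3 "Data dependence of fixed
points" (the quantity `t_η` of (9), Example 7.4, the Remark after it, Theorem 7.5 and the Remark
after it, Theorem 7.6 with Remarks 1)–3), Theorem 7.7; Lemmas 7.2 and 7.3, Definitions 7.5–7.8,
Example 7.5 1), Theorem 7.8, Corollary 7.1) and §7.4 "Sequences of applications and fixed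
points" (Theorems 7.9, 7.10, 7.11, 7.12), pp. 166–175.  By §7.5, Theorems 7.5, 7.7, 7.10–7.12
are Theorems 7.1.1, 7.1.2, 7.2.1–7.2.3 of I. A. Rus, *Generalized Contractions and Applications*
(2001), Theorem 7.6 is from Berinde (1997), Theorem 7.8 is Theorem 2.1 of Rus–Petruşel–Sîntămărian
(2003), Corollary 7.1 is Lim's (1985) and Theorem 7.9 is Nadler's [Nad69, Theorem 1].

Setting.  `(X, d)` a metric space, `T, U : X → X`; comparison functions, (c)-comparison functions
and `φ`-contractions are those of `Literature.Analysis.Convex.PhiContractions` (Berinde Ch. 2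
§2.5), used BY NAME.  A *strict comparison function* (Definition 2.3 (3), condition (vii_φ)) is a
comparison function with `t - φ(t) → ∞` (`IsStrictComparisonFunction`), and for `η ≥ 0`

  `t_η = sup {t ≥ 0 : t - φ(t) ≤ η}`                                                  (9)

(`tEta`).  What is proved:

* §7.3, single-valued maps.  Example 7.4 (1): `t_η = η / (1 - a)` for `φ(t) = a t`
  (`tEta_mul`).  Theorem 7.5: if `T` is a `φ`-contraction with `φ` strict, `T p = p`, `U q = q`
  and `d(Tx, Ux) ≤ η` for all `x`, then `d(p, q) ≤ t_η` (`dist_fixedPoint_le_tEta`; with the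
  existence of `p` on a complete space, `exists_fixedPoint_dist_le_tEta`).  The Remark after
  Example 7.4 (`t_η → 0` as `η → 0`) for CONTINUOUS `φ` (`IsStrictComparisonFunction.tendsto_tEta`)
  together with a strict comparison function for which it fails (`phiJump`,
  `isStrictComparisonFunction_phiJump`, `one_add_le_tEta_phiJump`, `not_tendsto_tEta_phiJump`);
  the Remark after Theorem 7.5 (`d(p, q) → 0` as `η → 0`) as printed, for every strict `φ`
  (`dist_fixedPoint_lt_of_small`), through the iteration lemma
  `IsStrictComparisonFunction.exists_forall_lt_of_le_iterate` — see deviation (b).  Theorem 7.6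
  (a subadditive (c)-comparison
  function, `y_n = Uⁿ x₀`, `x_n = Tⁿ x₀`): `d(y_n, x_n) ≤ ∑_{k<n} φᵏ(η)`
  (`dist_iterate_iterate_le_sum`), 1) `d(y_n, p) ≤ s(η) + s(d(x_n, x_{n+1}))`
  (`dist_iterate_fixedPoint_le_tsum_add`), 2) `d(p, q) ≤ s(η)` (`dist_fixedPoint_le_tsum`), and
  the a priori form (13) of Remark 2) (`dist_iterate_fixedPoint_le_tsum_add_apriori`).
  Theorem 7.7: for a family `T_λ` of `φ`-contractions, `φ` strict, depending continuously on
  `λ` at each point, the fixed point `x*_λ` depends continuously on `λ`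
  (`continuous_fixedPoint_of_isPhiContraction`, pointwise `continuousAt_…`; the case
  `φ(t) = K t` with the same separate-continuity sharpening is
  `Literature.Analysis.Calculus.continuous_fixedPoint` of `ParametricContraction.lean`, Copson
  1968 §80 — not imported here).  The common core of 7.5-Remark/7.7/7.10/7.11: fixed points of
  `φ`-contractions `T_i` with `T_i x* → x*` converge to `x*` along any filter
  (`tendsto_fixedPoint_of_tendsto_apply`).
* §7.4.  Theorem 7.9 (Nadler): fixed points of maps converging uniformly to an `a`-contraction
  converge to its fixed point (`tendsto_fixedPoint_of_tendstoUniformly`).  Theorem 7.10: a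
  pointwise limit of `φ`-contractions is a `φ`-contraction (`isPhiContraction_of_tendsto`) and,
  for `φ` strict, the fixed points converge (`tendsto_fixedPoint_of_tendsto`; the proof only uses
  `T_n x* → T x*`, `tendsto_fixedPoint_of_tendsto_at`; existence form on a complete space
  `exists_fixedPoint_tendsto_fixedPoint`).  Theorem 7.11 (uniform convergence,
  `tendsto_fixedPoint_of_tendstoUniformly'`).  Theorem 7.12: `T_n` `φ_n`-contractions converging
  pointwise to a `φ`-contraction `T` whose fixed point `x*` has a compact closed ball around it —
  then `x_n* → x*` (`tendsto_fixedPoint_of_isCompact_closedBall`; on a locally compact space,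
  `tendsto_fixedPoint_of_locallyCompact`).
* §7.3, multivalued maps `T : X → 𝒫(X)`.  Lemma 7.2 (`exists_edist_lt_mul_hausdorffEDist`),
  Lemma 7.3 (`hausdorffEDist_le_of_forall_exists`); Definition 7.5 (`mFix`), Definitions 7.6–7.8
  (`IsSuccApprox`, `IsMWPicard`, `Tinf`, `IsCMWPicard`) and the quantitative content of
  Definition 7.8 that Theorem 7.8 uses (`FixedPointsNear`, `IsCMWPicard.fixedPointsNear`);
  Theorem 7.8: `H(Fix T₁, Fix T₂) ≤ η · max {c₁, c₂}` (`hausdorffEDist_mFix_le`, book form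
  `hausdorffEDist_mFix_le_of_isCMWPicard`); Example 7.5 1) = Nadler's theorem with its
  quantitative supplement: a multivalued `a`-contraction with closed values on a complete space
  is a `(1 - a)⁻¹`-multivalued weakly Picard operator (`IsMContraction.exists_succApprox`,
  `IsMContraction.isCMWPicard`); Corollary 7.1 (Lim): `H(Fix T₁, Fix T₂) ≤ (1 - k)⁻¹ sup_x
  H(T₁ x, T₂ x)` (`hausdorffEDist_mFix_le_of_isMContraction`, `…_iSup`).

Deviations from the source (declared).
(a) As in `PhiContractions`, comparison functions are maps `ℝ → ℝ`, monotone on `ℝ`, nonnegative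
    on `[0, ∞)`; `t_η` is the supremum in `ℝ` of the (nonempty, bounded above) set (9).
(b) The Remark after Example 7.4, `lim_{η → 0} t_η = 0`, is FALSE for a general strict comparison
    function: `φ(t) = t/2 (t ≤ 1), = 1 (t > 1)` is one (monotone, `φⁿ(t) → 0`, `t - φ(t) → ∞`)
    and `t = 1 + η` satisfies `t - φ(t) = η`, so `t_η ≥ 1 + η` for every `η > 0`
    (`one_add_le_tEta_phiJump`, `not_tendsto_tEta_phiJump`); it does hold when `φ` is moreover
    continuous (`IsStrictComparisonFunction.tendsto_tEta`, from `inf_{t ≥ ε} (t - φ(t)) > 0`,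
    `exists_pos_forall_le_sub`), e.g. for the book's examples `a t` and `t/(1 + t)`.  The book's
    proofs of the Remark after Theorem 7.5, of Theorem 7.7 and of Theorems 7.10/7.11 all invoke
    the false Remark ("see Remark following Example 7.4", p. 173).  The four STATEMENTS are
    nevertheless true as printed (no continuity), and are proved here by a different argument,
    the iteration lemma `exists_forall_lt_of_le_iterate`: iterating the contraction `k` times
    gives `d ≤ φᵏ(d) + k ε` (instead of (14) `d ≤ φ(d) + ε`), (vii_φ) with `k = 1` bounds
    `d ≤ M`, and `φᵏ(M) → 0` by (iii_φ); so `d < ε'` once `ε` is small.  The quantity `t_η`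
    itself is only used for Theorem 7.5, which holds as printed.
(c) Theorem 7.7 is proved from the continuity of `λ ↦ T(x, λ)` at `λ₁` for the single point
    `x = x*_{λ₁}` (weaker than the joint continuity assumed in the book): for `λ₂ → λ₁` we use
    `d(T_{λ₂} x*_{λ₁}, T_{λ₁} x*_{λ₁}) → 0`, whereas the book's estimate ends in
    `d(T_{λ₁} x*_{λ₂}, T_{λ₂} x*_{λ₂})` with the moving point `x*_{λ₂}`, whose convergence to `0`
    does not follow from the continuity of `T` alone.
(d) In Theorems 7.5, 7.9–7.12 the fixed points (`T p = p`, `T_n x_n* = x_n*`, `T x* = x*`) are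
    hypotheses, so completeness is not needed there (uniqueness is automatic for `φ`-contractions);
    existence versions on complete spaces are given for 7.5 and 7.10.  Theorem 7.12 is proved
    for comparison functions `φ_n, φ` (the book says strict) assuming only a compact closed ball
    around `x*`; the book gives no proof — ours is Nadler's [Nad69, Thm. 2]: pointwise convergence
    of nonexpansive maps is uniform on the compact ball, which is then `T_n`-invariant and contains
    the fixed point of `T_n` by Theorem 2.2 (Nemytzki–Edelstein) and uniqueness.
(e) Multivalued maps are `T : X → Set X`; `H` is Mathlib's `ℝ≥0∞`-valued Hausdorff edistance
    `Metric.hausdorffEDist` (the book's generalized functional `H_d` on `𝒫(X)`), `D` is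
    `Metric.infEDist` / `Metric.infDist`.  Lemma 7.2 is stated for `0 < H(A, B) < ∞` (as printed
    it fails when `H(A, B) = 0`, e.g. `A = [0, 1]`, `B = [0, 1)`, `a = 1`).  The metric content of
    Definition 7.8 used by Theorem 7.8 — for `y ∈ T x` and `ε > 0` some fixed point `z` has
    `d(x, z) ≤ c d(x, y) + ε` — is isolated as `FixedPointsNear c T`; it follows from Definition
    7.8 and Theorem 7.8 is proved from it (so in a slightly stronger form), with `η ≥ 0` a real
    number as in the book.  Example 7.5 1) assumes closed values (as Nadler; needed for the limit
    of the successive approximations to be a fixed point); Example 7.5 2), 3), Example 7.4 2),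
    Remark 1) after Theorem 7.11 and Theorem 7.13 (a characterisation of finite dimension) are
    not formalised.
-/

open Filter Topology Function Set Metric
open scoped ENNReal NNReal

namespace Literature.Analysis.Convex.FixedPointDataDependence

open Literature.Analysis.Convex.PhiContractions

variable {X : Type*} [MetricSpace X]

/-! ## Strict comparison functions and the quantity `t_η` of (9) -/

/-- A *strict comparison function* (Definition 2.3 (3)): a comparison function ((i_φ), (v_φ))
satisfying (vii_φ) `t - φ(t) → ∞` as `t → ∞`.
[cite: Berinde2007, Ch. 2 §2.5 Def 2.3 (3); Ch. 7 §7.3 (9)] -/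
structure IsStrictComparisonFunction (φ : ℝ → ℝ) : Prop extends IsComparisonFunction φ where
  tendsto_sub_atTop : Tendsto (fun t => t - φ t) atTop atTop

/-- The set `{t ∈ ℝ₊ : t - φ(t) ≤ η}` of (9). [cite: Berinde2007, Ch. 7 §7.3 (9)] -/
def tEtaSet (φ : ℝ → ℝ) (η : ℝ) : Set ℝ := {t | 0 ≤ t ∧ t - φ t ≤ η}

/-- `t_η = sup {t ∈ ℝ₊ : t - φ(t) ≤ η}` of (9). [cite: Berinde2007, Ch. 7 §7.3 (9)] -/
noncomputable def tEta (φ : ℝ → ℝ) (η : ℝ) : ℝ := sSup (tEtaSet φ η)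

section tEta

variable {φ : ℝ → ℝ}

/-- `0` belongs to the set (9) when `η ≥ 0`. [cite: Berinde2007, Ch. 7 §7.3 (9)] -/
theorem zero_mem_tEtaSet (hφ : IsComparisonFunction φ) {η : ℝ} (hη : 0 ≤ η) :
    (0 : ℝ) ∈ tEtaSet φ η :=
  ⟨le_rfl, by simpa [hφ.map_zero] using hη⟩

/-- (vii_φ): beyond some `M`, `t - φ(t) > η`. [cite: Berinde2007, Ch. 2 §2.5 (vii_φ)] -/
theorem IsStrictComparisonFunction.exists_forall_lt (hφ : IsStrictComparisonFunction φ) (η : ℝ) :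
    ∃ M, ∀ t, M ≤ t → η < t - φ t :=
  (hφ.tendsto_sub_atTop.eventually (eventually_gt_atTop η)).exists_forall_of_atTop

/-- For a strict comparison function the set (9) is bounded above, so `t_η` is a genuine
supremum. [cite: Berinde2007, Ch. 7 §7.3 (9)] -/
theorem IsStrictComparisonFunction.bddAbove_tEtaSet (hφ : IsStrictComparisonFunction φ) (η : ℝ) :
    BddAbove (tEtaSet φ η) := by
  obtain ⟨M, hM⟩ := hφ.exists_forall_lt η
  refine ⟨M, fun t ht => ?_⟩
  by_contra h
  exact absurd ht.2 (not_le.2 (hM t (not_le.1 h).le))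

/-- Every `t ≥ 0` with `t - φ(t) ≤ η` is `≤ t_η` (the step "which, by (9), gives `d(p,q) ≤ t_η`").
[cite: Berinde2007, Ch. 7 §7.3 (9), Thm 7.5 (proof)] -/
theorem IsStrictComparisonFunction.le_tEta (hφ : IsStrictComparisonFunction φ) {η t : ℝ}
    (ht : 0 ≤ t) (h : t - φ t ≤ η) : t ≤ tEta φ η :=
  le_csSup (hφ.bddAbove_tEtaSet η) ⟨ht, h⟩

/-- `t_η ≥ 0` for `η ≥ 0`. [cite: Berinde2007, Ch. 7 §7.3 (9)] -/
theorem IsStrictComparisonFunction.tEta_nonneg (hφ : IsStrictComparisonFunction φ) {η : ℝ}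
    (hη : 0 ≤ η) : 0 ≤ tEta φ η :=
  hφ.le_tEta le_rfl (by simpa [hφ.map_zero] using hη)

/-- An upper bound for the set (9) bounds `t_η`. [cite: Berinde2007, Ch. 7 §7.3 (9)] -/
theorem tEta_le (hφ : IsComparisonFunction φ) {η b : ℝ} (hη : 0 ≤ η)
    (h : ∀ t, 0 ≤ t → t - φ t ≤ η → t ≤ b) : tEta φ η ≤ b :=
  csSup_le ⟨0, zero_mem_tEtaSet hφ hη⟩ fun t ht => h t ht.1 ht.2

/-- Example 2.8 (1) / Example 7.4 (1): `φ(t) = a t`, `a ∈ [0, 1)`, is a strict comparison function.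
[cite: Berinde2007, Ch. 2 §2.5 Example 2.8 (1); Ch. 7 §7.3 Example 7.4] -/
theorem isStrictComparisonFunction_mul {a : ℝ} (ha0 : 0 ≤ a) (ha1 : a < 1) :
    IsStrictComparisonFunction (fun t => a * t) where
  toIsComparisonFunction := isComparisonFunction_mul ha0 ha1
  tendsto_sub_atTop := by
    have h : (fun t : ℝ => t - a * t) = fun t => (1 - a) * t := by funext t; ring
    rw [h]
    exact Tendsto.const_mul_atTop (sub_pos.2 ha1) tendsto_id

/-- **Example 7.4 (1)**: for `φ(t) = a t`, `a ∈ [0, 1)`, `t_η = η / (1 - a)`.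
[cite: Berinde2007, Ch. 7 §7.3 Example 7.4] -/
theorem tEta_mul {a η : ℝ} (ha1 : a < 1) (hη : 0 ≤ η) :
    tEta (fun t => a * t) η = η / (1 - a) := by
  have h1 : 0 < 1 - a := sub_pos.2 ha1
  have hset : tEtaSet (fun t => a * t) η = Icc 0 (η / (1 - a)) := by
    ext t
    simp only [tEtaSet, mem_setOf_eq, mem_Icc, le_div_iff₀ h1]
    constructor
    · rintro ⟨h0, h⟩
      exact ⟨h0, by nlinarith [h]⟩
    · rintro ⟨h0, h⟩
      exact ⟨h0, by nlinarith [h]⟩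
  rw [tEta, hset, csSup_Icc (div_nonneg hη h1.le)]

/-- The key fact behind the Remark after Example 7.4 for a CONTINUOUS strict comparison function:
`inf_{t ≥ ε} (t - φ(t)) > 0` for every `ε > 0` (continuity on the compact `[ε, M]`, (vii_φ)
beyond `M`). [cite: Berinde2007, Ch. 7 §7.3, Remark after Example 7.4] -/
theorem IsStrictComparisonFunction.exists_pos_forall_le_sub (hφ : IsStrictComparisonFunction φ)
    (hc : Continuous φ) {ε : ℝ} (hε : 0 < ε) : ∃ δ > 0, ∀ t, ε ≤ t → δ ≤ t - φ t := by
  obtain ⟨M, hM⟩ := hφ.exists_forall_lt 1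
  have hK : IsCompact (Icc ε (max ε M)) := isCompact_Icc
  have hne : (Icc ε (max ε M)).Nonempty := nonempty_Icc.2 (le_max_left _ _)
  have hcont : ContinuousOn (fun t => t - φ t) (Icc ε (max ε M)) :=
    (continuous_id.sub hc).continuousOn
  obtain ⟨t₀, ht₀, hmin⟩ := hK.exists_isMinOn hne hcont
  have hpos : 0 < t₀ - φ t₀ := hφ.sub_self_pos (hε.trans_le ht₀.1)
  refine ⟨min 1 (t₀ - φ t₀), lt_min one_pos hpos, fun t ht => ?_⟩
  by_cases htM : t ≤ max ε M
  · exact (min_le_right _ _).trans ((isMinOn_iff.1 hmin) t ⟨ht, htM⟩)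
  · have hMt : M ≤ t := (le_max_right ε M).trans (not_le.1 htM).le
    exact (min_le_left _ _).trans (hM t hMt).le

/-! ### The iteration lemma (replaces the Remark after Example 7.4 in the proofs, deviation (b)) -/

/-- (vii_φ) bounds every `t` with `t - φ(t) ≤ 1`. [cite: Berinde2007, Ch. 2 §2.5 (vii_φ)] -/
theorem IsStrictComparisonFunction.exists_bound (hφ : IsStrictComparisonFunction φ) :
    ∃ M, 0 ≤ M ∧ ∀ t, t - φ t ≤ 1 → t ≤ M := by
  obtain ⟨M₀, hM₀⟩ := hφ.exists_forall_lt 1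
  refine ⟨max M₀ 0, le_max_right _ _, fun t ht => ?_⟩
  by_contra h
  have hMt : M₀ ≤ t := (le_max_left _ _).trans (not_le.1 h).le
  linarith [hM₀ t hMt]

/-- **Iteration lemma** (our replacement for the Remark after Example 7.4, deviation (b)): for a
strict comparison function `φ` and `ε > 0` there is `δ > 0` such that `u ≥ 0`, `e < δ` and
`u ≤ φᵏ(u) + k e` for all `k ∈ ℕ` force `u < ε`.  (From `k = 1` and (vii_φ), `u ≤ M`; then
`u ≤ φᵏ(M) + k e` with `φᵏ(M) → 0`.)  No continuity of `φ` is needed.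
[cite: Berinde2007, Ch. 7 §7.3 Remark after Example 7.4; §7.4 Thm 7.10 (proof, (14))] -/
theorem IsStrictComparisonFunction.exists_forall_lt_of_le_iterate
    (hφ : IsStrictComparisonFunction φ) {ε : ℝ} (hε : 0 < ε) :
    ∃ δ > 0, ∀ u e : ℝ, 0 ≤ u → e < δ → (∀ k : ℕ, u ≤ φ^[k] u + k * e) → u < ε := by
  obtain ⟨M, hM0, hM⟩ := hφ.exists_bound
  obtain ⟨k, hk⟩ : ∃ k : ℕ, φ^[k] M < ε / 2 :=
    ((hφ.tendsto_iterate_zero M hM0).eventually (eventually_lt_nhds (half_pos hε))).exists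
  refine ⟨min 1 (ε / (2 * k + 2)), lt_min one_pos (by positivity), fun u e hu heδ hk' => ?_⟩
  have he1 : e < 1 := heδ.trans_le (min_le_left _ _)
  have he2 : e < ε / (2 * k + 2) := heδ.trans_le (min_le_right _ _)
  have huM : u ≤ M := by
    refine hM u ?_
    have h1 := hk' 1
    simp only [iterate_one, Nat.cast_one, one_mul] at h1
    linarith
  have hmono : φ^[k] u ≤ φ^[k] M := hφ.mono.iterate k huM
  have hk0 : (0 : ℝ) ≤ k := Nat.cast_nonneg k
  have hke : (k : ℝ) * e ≤ ε / 2 := by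
    rcases le_or_gt 0 e with he0 | he0
    · have h3 : (k : ℝ) * e ≤ k * (ε / (2 * k + 2)) := mul_le_mul_of_nonneg_left he2.le hk0
      have h4 : (k : ℝ) * (ε / (2 * k + 2)) ≤ ε / 2 := by
        rw [mul_div_assoc', div_le_div_iff₀ (by positivity) (by positivity)]
        nlinarith
      linarith
    · nlinarith
  have h5 := hk' k
  linarith

/-- Filter form of the iteration lemma: `uᵢ ≥ 0`, `uᵢ ≤ φᵏ(uᵢ) + k eᵢ` for all `k`, and `eᵢ → 0`
force `uᵢ → 0`. [cite: Berinde2007, Ch. 7 §7.4 Thm 7.10 (proof, (14))] -/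
theorem IsStrictComparisonFunction.tendsto_zero_of_le_iterate (hφ : IsStrictComparisonFunction φ)
    {ι : Type*} {l : Filter ι} {u e : ι → ℝ} (hu : ∀ i, 0 ≤ u i)
    (hle : ∀ i (k : ℕ), u i ≤ φ^[k] (u i) + k * e i) (he : Tendsto e l (𝓝 0)) :
    Tendsto u l (𝓝 0) := by
  rw [Metric.tendsto_nhds]
  intro ε hε
  obtain ⟨δ, hδ, h⟩ := hφ.exists_forall_lt_of_le_iterate hε
  filter_upwards [(tendsto_order.1 he).2 δ hδ] with i hi
  rw [Real.dist_0_eq_abs, abs_of_nonneg (hu i)]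
  exact h (u i) (e i) (hu i) hi (hle i)

/-! ### The Remark after Example 7.4: true for continuous `φ`, false in general -/

/-- The Remark after Example 7.4, quantitative form, for a CONTINUOUS strict comparison function:
`t_η ≤ ε` for all small `η ≥ 0`. [cite: Berinde2007, Ch. 7 §7.3 Remark after Example 7.4] -/
theorem IsStrictComparisonFunction.exists_forall_tEta_le (hφ : IsStrictComparisonFunction φ)
    (hc : Continuous φ) {ε : ℝ} (hε : 0 < ε) :
    ∃ δ > 0, ∀ η, 0 ≤ η → η < δ → tEta φ η ≤ ε := by
  obtain ⟨δ, hδ, hδle⟩ := hφ.exists_pos_forall_le_sub hc hε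
  refine ⟨δ, hδ, fun η hη0 hηδ => tEta_le hφ.toIsComparisonFunction hη0 fun t _ h => ?_⟩
  by_contra hlt
  have h1 := hδle t (not_le.1 hlt).le
  linarith

/-- **Remark after Example 7.4** (for continuous `φ`, deviation (b)): `t_η → 0` as `η → 0⁺`.
[cite: Berinde2007, Ch. 7 §7.3 Remark after Example 7.4] -/
theorem IsStrictComparisonFunction.tendsto_tEta (hφ : IsStrictComparisonFunction φ)
    (hc : Continuous φ) : Tendsto (tEta φ) (𝓝[≥] 0) (𝓝 0) := by
  rw [Metric.tendsto_nhdsWithin_nhds]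
  intro ε hε
  obtain ⟨δ, hδ, h⟩ := hφ.exists_forall_tEta_le hc (half_pos hε)
  refine ⟨δ, hδ, fun {η} hη hdist => ?_⟩
  have hη0 : 0 ≤ η := hη
  rw [Real.dist_0_eq_abs, abs_of_nonneg hη0] at hdist
  rw [Real.dist_0_eq_abs, abs_of_nonneg (hφ.tEta_nonneg hη0)]
  linarith [h η hη0 hdist]

/-! ### A strict comparison function for which the printed Remark fails (deviation (b)) -/

/-- `φ(t) = t / 2` for `t ≤ 1` and `φ(t) = 1` for `t > 1`. [cite: Berinde2007, Ch. 7 §7.3 Remark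
after Example 7.4 (counterexample to the Remark as printed; not in the source)] -/
noncomputable def phiJump (t : ℝ) : ℝ := if t ≤ 1 then t / 2 else 1

/-- [cite: Berinde2007, Ch. 7 §7.3 Remark after Example 7.4 (counterexample; not in the source)] -/
theorem phiJump_of_le_one {t : ℝ} (ht : t ≤ 1) : phiJump t = t / 2 := by simp [phiJump, ht]

/-- [cite: Berinde2007, Ch. 7 §7.3 Remark after Example 7.4 (counterexample; not in the source)] -/
theorem phiJump_of_one_lt {t : ℝ} (ht : 1 < t) : phiJump t = 1 := by simp [phiJump, not_le.2 ht]

/-- `φⁿ(t) = t / 2ⁿ` on `t ≤ 1`.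
[cite: Berinde2007, Ch. 7 §7.3 Remark after Example 7.4 (counterexample; not in the source)] -/
theorem phiJump_iterate_of_le_one {t : ℝ} (ht : t ≤ 1) (n : ℕ) : phiJump^[n] t = t / 2 ^ n := by
  induction n generalizing t with
  | zero => simp
  | succ n ih =>
    rw [iterate_succ_apply, phiJump_of_le_one ht, ih (by linarith)]
    rw [pow_succ]
    ring

/-- `phiJump` is a strict comparison function. [cite: Berinde2007, Ch. 2 §2.5 Def 2.3 (3)
(verification for the counterexample; not in the source)] -/
theorem isStrictComparisonFunction_phiJump : IsStrictComparisonFunction phiJump where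
  mono := by
    intro s t hst
    by_cases hs : s ≤ 1
    · by_cases ht : t ≤ 1
      · rw [phiJump_of_le_one hs, phiJump_of_le_one ht]; linarith
      · rw [phiJump_of_le_one hs, phiJump_of_one_lt (not_le.1 ht)]; linarith
    · have ht : 1 < t := (not_le.1 hs).trans_le hst
      rw [phiJump_of_one_lt (not_le.1 hs), phiJump_of_one_lt ht]
  nonneg := by
    intro t ht
    by_cases h : t ≤ 1
    · rw [phiJump_of_le_one h]; linarith
    · rw [phiJump_of_one_lt (not_le.1 h)]; norm_num
  tendsto_iterate_zero := by
    have hgeom : ∀ s : ℝ, Tendsto (fun n : ℕ => s / 2 ^ n) atTop (𝓝 0) := by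
      intro s
      have h := (tendsto_pow_atTop_nhds_zero_of_lt_one (r := (1 / 2 : ℝ)) (by norm_num)
        (by norm_num)).const_mul s
      rw [mul_zero] at h
      refine h.congr fun n => ?_
      rw [one_div, inv_pow, div_eq_mul_inv]
    intro t ht
    by_cases h : t ≤ 1
    · refine (hgeom t).congr fun n => ?_
      rw [phiJump_iterate_of_le_one h]
    · rw [← tendsto_add_atTop_iff_nat 1]
      have h1 : ∀ n, phiJump^[n + 1] t = 1 / 2 ^ n := by
        intro n
        rw [iterate_succ_apply, phiJump_of_one_lt (not_le.1 h), phiJump_iterate_of_le_one le_rfl]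
      refine (hgeom 1).congr fun n => (h1 n).symm
  tendsto_sub_atTop := by
    rw [tendsto_atTop_atTop]
    intro b
    refine ⟨max 2 (b + 1), fun t ht => ?_⟩
    have ht1 : 1 < t := by linarith [le_max_left 2 (b + 1)]
    rw [phiJump_of_one_lt ht1]
    linarith [le_max_right 2 (b + 1)]

/-- For `phiJump`, `t = 1 + η` lies in the set (9), so `t_η ≥ 1 + η` for every `η > 0`: the
Remark "`lim_{η → 0} t_η = 0`" fails without continuity of `φ`. [cite: Berinde2007, Ch. 7 §7.3
Remark after Example 7.4 (fails as printed; not in the source)] -/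
theorem one_add_le_tEta_phiJump {η : ℝ} (hη : 0 < η) : 1 + η ≤ tEta phiJump η := by
  refine isStrictComparisonFunction_phiJump.le_tEta (by linarith) ?_
  rw [phiJump_of_one_lt (by linarith)]
  linarith

/-- Hence `t_η ↛ 0` as `η → 0⁺` for the strict comparison function `phiJump`.
[cite: Berinde2007, Ch. 7 §7.3 Remark after Example 7.4 (fails as printed; not in the source)] -/
theorem not_tendsto_tEta_phiJump : ¬ Tendsto (tEta phiJump) (𝓝[>] 0) (𝓝 0) := by
  intro h
  have h1 : ∀ᶠ η in 𝓝[>] (0 : ℝ), tEta phiJump η < 1 := (tendsto_order.1 h).2 1 one_pos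
  have h2 : ∀ᶠ η in 𝓝[>] (0 : ℝ), η ∈ Ioi (0 : ℝ) := self_mem_nhdsWithin
  obtain ⟨η, hlt, hpos⟩ := (h1.and h2).exists
  have := one_add_le_tEta_phiJump (mem_Ioi.1 hpos)
  linarith [mem_Ioi.1 hpos]

end tEta

/-! ## Theorem 7.5 and the Remark after it -/

section SingleValued

variable {φ : ℝ → ℝ} {T U : X → X}

/-- **Theorem 7.5** (Rus).  If `T` is a `φ`-contraction with `φ` a strict comparison function,
`T p = p`, `U q = q` and `d(Tx, Ux) ≤ η` for all `x`, then `d(p, q) ≤ t_η`.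
[cite: Berinde2007, Ch. 7 §7.3 Thm 7.5] -/
theorem dist_fixedPoint_le_tEta (hφ : IsStrictComparisonFunction φ) (hT : IsPhiContraction T φ)
    {p q : X} (hp : T p = p) (hq : U q = q) {η : ℝ} (hTU : ∀ x, dist (T x) (U x) ≤ η) :
    dist p q ≤ tEta φ η := by
  refine hφ.le_tEta dist_nonneg ?_
  have h : dist p q ≤ φ (dist p q) + η := by
    calc dist p q = dist (T p) (U q) := by rw [hp, hq]
      _ ≤ dist (T p) (T q) + dist (T q) (U q) := dist_triangle _ _ _
      _ ≤ φ (dist p q) + η := add_le_add (hT p q) (hTU q)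
  linarith

/-- Theorem 7.5 with the existence of the fixed point of `T` (Theorem 2.7) on a complete space.
[cite: Berinde2007, Ch. 7 §7.3 Thm 7.5] -/
theorem exists_fixedPoint_dist_le_tEta [CompleteSpace X] (hφ : IsStrictComparisonFunction φ)
    (hT : IsPhiContraction T φ) {q : X} (hq : U q = q) {η : ℝ} (hTU : ∀ x, dist (T x) (U x) ≤ η) :
    ∃ p : X, T p = p ∧ dist p q ≤ tEta φ η := by
  obtain ⟨p, hp, -⟩ := hT.exists_fixedPoint_tendsto_iterate hφ.toIsComparisonFunction q
  exact ⟨p, hp, dist_fixedPoint_le_tEta hφ hT hp hq hTU⟩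

/-- For a nonexpansive `T` and any `U` with `d(Tx, Ux) ≤ η`: `d(Uᵏ x₀, Tᵏ x₀) ≤ k η`.
[cite: Berinde2007, Ch. 7 §7.3 Thm 7.6 (proof), with `φ(t) ≤ t`] -/
theorem dist_iterate_iterate_le_mul (hT : ∀ x y, dist (T x) (T y) ≤ dist x y) {η : ℝ}
    (hTU : ∀ x, dist (T x) (U x) ≤ η) (x₀ : X) (k : ℕ) :
    dist (U^[k] x₀) (T^[k] x₀) ≤ k * η := by
  induction k with
  | zero => simp
  | succ k ih =>
    rw [iterate_succ_apply', iterate_succ_apply', Nat.cast_succ]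
    calc dist (U (U^[k] x₀)) (T (T^[k] x₀))
        ≤ dist (U (U^[k] x₀)) (T (U^[k] x₀)) + dist (T (U^[k] x₀)) (T (T^[k] x₀)) :=
          dist_triangle _ _ _
      _ ≤ η + dist (U^[k] x₀) (T^[k] x₀) := by
          refine add_le_add ?_ (hT _ _)
          rw [dist_comm]; exact hTU _
      _ ≤ (k + 1) * η := by linarith

/-- For a nonexpansive `T` and any point `o`: `d(Tᵏ o, o) ≤ k d(T o, o)`.
[cite: Berinde2007, Ch. 7 §7.4 Thm 7.10 (proof)] -/
theorem dist_iterate_self_le_mul (hT : ∀ x y, dist (T x) (T y) ≤ dist x y) (o : X) (k : ℕ) :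
    dist (T^[k] o) o ≤ k * dist (T o) o := by
  induction k with
  | zero => simp
  | succ k ih =>
    rw [iterate_succ_apply', Nat.cast_succ]
    calc dist (T (T^[k] o)) o ≤ dist (T (T^[k] o)) (T o) + dist (T o) o := dist_triangle _ _ _
      _ ≤ dist (T^[k] o) o + dist (T o) o := add_le_add (hT _ _) le_rfl
      _ ≤ (k + 1) * dist (T o) o := by linarith

/-- The inequality fed to the iteration lemma: for a `φ`-contraction `T` with fixed point `x`
and any point `o`, `d(o, x) ≤ φᵏ(d(o, x)) + k d(T o, o)` for every `k`
(`d(o, x) ≤ d(o, Tᵏ o) + d(Tᵏ o, Tᵏ x)`). [cite: Berinde2007, Ch. 7 §7.4 Thm 7.10 (proof, (14))] -/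
theorem dist_fixedPoint_le_iterate_add_mul (hφ : IsComparisonFunction φ) (hT : IsPhiContraction T φ)
    {x : X} (hx : T x = x) (o : X) (k : ℕ) :
    dist o x ≤ φ^[k] (dist o x) + k * dist (T o) o := by
  have h1 : dist o x ≤ dist (T^[k] o) o + dist (T^[k] o) x := dist_triangle_left _ _ _
  have h2 : dist (T^[k] o) x ≤ φ^[k] (dist o x) := hT.dist_iterate_fixedPoint_le hφ hx o k
  have h3 : dist (T^[k] o) o ≤ k * dist (T o) o := dist_iterate_self_le_mul (hT.dist_le hφ) o k
  linarith

/-- **Fixed points move continuously with the operator** (the common core of the Remark after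
Theorem 7.5 and Theorems 7.7, 7.10, 7.11; deviation (b)): if the `T_i` are `φ`-contractions with
`φ` a strict comparison function, `T_i x_i = x_i`, and `T_i x* → x*` along a filter, then
`x_i → x*` along it. [cite: Berinde2007, Ch. 7 §7.4 Thm 7.10 (proof, (14))] -/
theorem tendsto_fixedPoint_of_tendsto_apply (hφ : IsStrictComparisonFunction φ) {ι : Type*}
    {l : Filter ι} {Ti : ι → X → X} (hTi : ∀ i, IsPhiContraction (Ti i) φ) {xs : X}
    {xi : ι → X} (hxi : ∀ i, Ti i (xi i) = xi i) (hpt : Tendsto (fun i => Ti i xs) l (𝓝 xs)) :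
    Tendsto xi l (𝓝 xs) := by
  have he : Tendsto (fun i => dist (Ti i xs) xs) l (𝓝 0) := by
    rw [tendsto_iff_dist_tendsto_zero] at hpt
    exact hpt
  have hu : Tendsto (fun i => dist xs (xi i)) l (𝓝 0) :=
    hφ.tendsto_zero_of_le_iterate (fun i => dist_nonneg)
      (fun i k => dist_fixedPoint_le_iterate_add_mul hφ.toIsComparisonFunction (hTi i) (hxi i) xs k)
      he
  rw [tendsto_iff_dist_tendsto_zero]
  simpa [dist_comm] using hu

/-- **Remark after Theorem 7.5** (as printed, without continuity of `φ`; deviation (b)):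
`d(p, q) → 0` as `η → 0` — for every `ε > 0` there is `δ > 0` such that every operator `U` with a
fixed point `q` and `d(Tx, Ux) ≤ η < δ` has `d(p, q) < ε`.  Proof: `d(p, q) ≤ φᵏ(d(p, q)) + k η`
(`d(q, Tᵏ q) = d(Uᵏ q, Tᵏ q) ≤ k η`, `d(Tᵏ q, p) ≤ φᵏ(d(q, p))`) and the iteration lemma.
[cite: Berinde2007, Ch. 7 §7.3 Remark after Thm 7.5] -/
theorem dist_fixedPoint_lt_of_small (hφ : IsStrictComparisonFunction φ) (hT : IsPhiContraction T φ)
    {p : X} (hp : T p = p) {ε : ℝ} (hε : 0 < ε) :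
    ∃ δ > 0, ∀ (U : X → X) (q : X) (η : ℝ), η < δ → U q = q →
      (∀ x, dist (T x) (U x) ≤ η) → dist p q < ε := by
  obtain ⟨δ, hδ, h⟩ := hφ.exists_forall_lt_of_le_iterate hε
  refine ⟨δ, hδ, fun U q η hηδ hq hTU => ?_⟩
  rw [dist_comm]
  refine h (dist q p) η dist_nonneg hηδ fun k => ?_
  have hφ' := hφ.toIsComparisonFunction
  have h1 : dist q p ≤ dist (T^[k] q) q + dist (T^[k] q) p := dist_triangle_left _ _ _
  have h2 : dist (T^[k] q) p ≤ φ^[k] (dist q p) := hT.dist_iterate_fixedPoint_le hφ' hp q k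
  have h3 : dist (T^[k] q) q ≤ k * η := by
    have h4 := dist_iterate_iterate_le_mul (hT.dist_le hφ') hTU q k
    rwa [iterate_fixed hq k, dist_comm] at h4
  linarith

/-! ## Theorem 7.6 and Remarks 1)–3) after it -/

/-- A subadditive monotone `φ` with `φ(0) = 0` is subadditive over finite sums of nonnegative
reals ((viii_φ) iterated, the "simple induction" of the proof of Theorem 7.6).
[cite: Berinde2007, Ch. 7 §7.3 Thm 7.6 (proof)] -/
theorem map_sum_le_sum_map (hφ : IsComparisonFunction φ)
    (hsub : ∀ a b, 0 ≤ a → 0 ≤ b → φ (a + b) ≤ φ a + φ b) {f : ℕ → ℝ} (hf : ∀ k, 0 ≤ f k)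
    (n : ℕ) : φ (∑ k ∈ Finset.range n, f k) ≤ ∑ k ∈ Finset.range n, φ (f k) := by
  induction n with
  | zero => simp [hφ.map_zero]
  | succ n ih =>
    rw [Finset.sum_range_succ, Finset.sum_range_succ]
    calc φ (∑ k ∈ Finset.range n, f k + f n)
        ≤ φ (∑ k ∈ Finset.range n, f k) + φ (f n) :=
          hsub _ _ (Finset.sum_nonneg fun k _ => hf k) (hf n)
      _ ≤ (∑ k ∈ Finset.range n, φ (f k)) + φ (f n) := add_le_add ih le_rfl

/-- Theorem 7.6, the estimate `d(y_n, x_n) ≤ η + φ(η) + … ` (here with `n` terms,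
`∑_{k<n} φᵏ(η)`), for `y_n = Uⁿ x₀`, `x_n = Tⁿ x₀`, `φ` subadditive.
[cite: Berinde2007, Ch. 7 §7.3 Thm 7.6 (proof)] -/
theorem dist_iterate_iterate_le_sum (hφ : IsComparisonFunction φ)
    (hsub : ∀ a b, 0 ≤ a → 0 ≤ b → φ (a + b) ≤ φ a + φ b) (hT : IsPhiContraction T φ)
    {η : ℝ} (hTU : ∀ x, dist (T x) (U x) ≤ η) (x₀ : X) (n : ℕ) :
    dist (U^[n] x₀) (T^[n] x₀) ≤ ∑ k ∈ Finset.range n, φ^[k] η := by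
  have hη : 0 ≤ η := dist_nonneg.trans (hTU x₀)
  induction n with
  | zero => simp
  | succ n ih =>
    rw [iterate_succ_apply', iterate_succ_apply', Finset.sum_range_succ']
    calc dist (U (U^[n] x₀)) (T (T^[n] x₀))
        ≤ dist (U (U^[n] x₀)) (T (U^[n] x₀)) + dist (T (U^[n] x₀)) (T (T^[n] x₀)) :=
          dist_triangle _ _ _
      _ ≤ η + φ (dist (U^[n] x₀) (T^[n] x₀)) := by
          refine add_le_add ?_ (hT _ _)
          rw [dist_comm]; exact hTU _
      _ ≤ η + φ (∑ k ∈ Finset.range n, φ^[k] η) := by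
          have := hφ.mono ih
          linarith
      _ ≤ η + ∑ k ∈ Finset.range n, φ (φ^[k] η) :=
          add_le_add le_rfl (map_sum_le_sum_map hφ hsub (fun k => hφ.iterate_nonneg hη k) n)
      _ = (∑ k ∈ Finset.range n, φ^[k + 1] η) + φ^[0] η := by
          rw [add_comm]
          congr 1
          refine Finset.sum_congr rfl fun k _ => ?_
          rw [iterate_succ_apply']

/-- Theorem 7.6, intermediate form of 1): `d(y_n, p) ≤ ∑_{k<n} φᵏ(η) + d(x_n, p)`.
[cite: Berinde2007, Ch. 7 §7.3 Thm 7.6 (12)] -/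
theorem dist_iterate_fixedPoint_le_sum_add (hφ : IsComparisonFunction φ)
    (hsub : ∀ a b, 0 ≤ a → 0 ≤ b → φ (a + b) ≤ φ a + φ b) (hT : IsPhiContraction T φ)
    {η : ℝ} (hTU : ∀ x, dist (T x) (U x) ≤ η) (p x₀ : X) (n : ℕ) :
    dist (U^[n] x₀) p ≤ (∑ k ∈ Finset.range n, φ^[k] η) + dist (T^[n] x₀) p :=
  (dist_triangle _ (T^[n] x₀) _).trans
    (add_le_add (dist_iterate_iterate_le_sum hφ hsub hT hTU x₀ n) le_rfl)

/-- **Theorem 7.6 1)** (Berinde): for a `φ`-contraction `T` with `φ` a subadditive (c)-comparison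
function, `T p = p`, and `U` with `d(Tx, Ux) ≤ η`: `d(y_n, p) ≤ s(η) + s(d(x_n, x_{n+1}))`, where
`y_n = Uⁿ x₀`, `x_n = Tⁿ x₀`, `s(t) = ∑ₖ φᵏ(t)` ((11)).
[cite: Berinde2007, Ch. 7 §7.3 Thm 7.6 1) (11)] -/
theorem dist_iterate_fixedPoint_le_tsum_add (hφ : IsCComparisonFunction φ)
    (hsub : ∀ a b, 0 ≤ a → 0 ≤ b → φ (a + b) ≤ φ a + φ b) (hT : IsPhiContraction T φ)
    {η : ℝ} (hTU : ∀ x, dist (T x) (U x) ≤ η) {p : X} (hp : T p = p) (x₀ : X) (n : ℕ) :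
    dist (U^[n] x₀) p ≤
      (∑' k, φ^[k] η) + ∑' k, φ^[k] (dist (T^[n] x₀) (T^[n + 1] x₀)) := by
  have hη : 0 ≤ η := dist_nonneg.trans (hTU x₀)
  have hφ' := hφ.isComparisonFunction
  have h1 := dist_iterate_fixedPoint_le_sum_add hφ' hsub hT hTU p x₀ n
  have h2 : (∑ k ∈ Finset.range n, φ^[k] η) ≤ ∑' k, φ^[k] η :=
    (hφ.summable_iterate η hη).sum_le_tsum (Finset.range n) fun k _ => hφ'.iterate_nonneg hη k
  have h3 := hT.dist_iterate_fixedPoint_le_tsum' hφ hp x₀ n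
  linarith

/-- **Theorem 7.6 2)**: `d(p, q) ≤ s(η)` for the fixed points `p` of `T` and `q` of `U`
(take `x₀ = q` in the intermediate estimate and let `n → ∞`).
[cite: Berinde2007, Ch. 7 §7.3 Thm 7.6 2)] -/
theorem dist_fixedPoint_le_tsum (hφ : IsCComparisonFunction φ)
    (hsub : ∀ a b, 0 ≤ a → 0 ≤ b → φ (a + b) ≤ φ a + φ b) (hT : IsPhiContraction T φ)
    {η : ℝ} (hTU : ∀ x, dist (T x) (U x) ≤ η) {p q : X} (hp : T p = p) (hq : U q = q) :
    dist p q ≤ ∑' k, φ^[k] η := by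
  have hη : 0 ≤ η := dist_nonneg.trans (hTU q)
  have hφ' := hφ.isComparisonFunction
  -- `d(q, p) ≤ ∑_{k<n} φᵏ(η) + d(Tⁿ q, p) ≤ s(η) + d(Tⁿ q, p)` for every `n`
  have hle : ∀ n, dist q p ≤ (∑' k, φ^[k] η) + dist (T^[n] q) p := by
    intro n
    have h1 := dist_iterate_fixedPoint_le_sum_add hφ' hsub hT hTU p q n
    rw [iterate_fixed hq n] at h1
    have h2 : (∑ k ∈ Finset.range n, φ^[k] η) ≤ ∑' k, φ^[k] η :=
      (hφ.summable_iterate η hη).sum_le_tsum (Finset.range n) fun k _ => hφ'.iterate_nonneg hη k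
    linarith
  have hlim : Tendsto (fun n => (∑' k, φ^[k] η) + dist (T^[n] q) p) atTop
      (𝓝 ((∑' k, φ^[k] η) + 0)) := by
    refine tendsto_const_nhds.add ?_
    have := hT.tendsto_iterate_fixedPoint hφ' hp q
    rw [tendsto_iff_dist_tendsto_zero] at this
    exact this
  rw [add_zero] at hlim
  rw [dist_comm]
  exact ge_of_tendsto' hlim hle

/-- **Remark 2) after Theorem 7.6**, the a priori estimate (13):
`d(y_n, p) ≤ s(η) + s(φⁿ(d(x₀, Tx₀)))`.
[cite: Berinde2007, Ch. 7 §7.3 Thm 7.6 Remark 2) (13)] -/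
theorem dist_iterate_fixedPoint_le_tsum_add_apriori (hφ : IsCComparisonFunction φ)
    (hsub : ∀ a b, 0 ≤ a → 0 ≤ b → φ (a + b) ≤ φ a + φ b) (hT : IsPhiContraction T φ)
    {η : ℝ} (hTU : ∀ x, dist (T x) (U x) ≤ η) {p : X} (hp : T p = p) (x₀ : X) (n : ℕ) :
    dist (U^[n] x₀) p ≤ (∑' k, φ^[k] η) + ∑' m, φ^[m] (φ^[n] (dist x₀ (T x₀))) := by
  have hη : 0 ≤ η := dist_nonneg.trans (hTU x₀)
  have hφ' := hφ.isComparisonFunction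
  have h1 := dist_iterate_fixedPoint_le_sum_add hφ' hsub hT hTU p x₀ n
  have h2 : (∑ k ∈ Finset.range n, φ^[k] η) ≤ ∑' k, φ^[k] η :=
    (hφ.summable_iterate η hη).sum_le_tsum (Finset.range n) fun k _ => hφ'.iterate_nonneg hη k
  have h3 := hT.dist_iterate_fixedPoint_le_tsum_apriori hφ x₀
    (hT.tendsto_iterate_fixedPoint hφ' hp x₀) n
  have h4 : (∑' m, φ^[n + m] (dist x₀ (T x₀))) = ∑' m, φ^[m] (φ^[n] (dist x₀ (T x₀))) := by
    refine tsum_congr fun m => ?_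
    rw [add_comm, iterate_add_apply]
  linarith

/-! ## Theorem 7.7: continuous dependence of the fixed point on a parameter -/

/-- **Theorem 7.7** (Rus; deviations (b), (c)).  Let `T : Y → X → X` be a family of
`φ`-contractions, `φ` a strict comparison function, with `λ ↦ T_λ x` continuous for every `x`,
and let `x*_λ` be the fixed point of `T_λ`.  Then `λ ↦ x*_λ` is continuous.
[cite: Berinde2007, Ch. 7 §7.3 Thm 7.7] -/
theorem continuous_fixedPoint_of_isPhiContraction {Y : Type*} [TopologicalSpace Y]
    (hφ : IsStrictComparisonFunction φ) {T : Y → X → X} (hT : ∀ l, IsPhiContraction (T l) φ)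
    (hcont : ∀ x, Continuous fun l => T l x) {xs : Y → X} (hfix : ∀ l, T l (xs l) = xs l) :
    Continuous xs := by
  refine continuous_iff_continuousAt.2 fun l₁ => ?_
  have hpt : Tendsto (fun l => T l (xs l₁)) (𝓝 l₁) (𝓝 (xs l₁)) := by
    have := (hcont (xs l₁)).tendsto l₁
    rwa [hfix] at this
  exact tendsto_fixedPoint_of_tendsto_apply hφ hT hfix hpt

/-- Theorem 7.7, pointwise form: continuity of `λ ↦ T_λ x*_{λ₁}` at `λ₁` alone gives continuity
of `λ ↦ x*_λ` at `λ₁`. [cite: Berinde2007, Ch. 7 §7.3 Thm 7.7] -/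
theorem continuousAt_fixedPoint_of_isPhiContraction {Y : Type*} [TopologicalSpace Y]
    (hφ : IsStrictComparisonFunction φ) {T : Y → X → X} (hT : ∀ l, IsPhiContraction (T l) φ)
    {xs : Y → X} (hfix : ∀ l, T l (xs l) = xs l) {l₁ : Y}
    (hcont : ContinuousAt (fun l => T l (xs l₁)) l₁) : ContinuousAt xs l₁ := by
  have hpt : Tendsto (fun l => T l (xs l₁)) (𝓝 l₁) (𝓝 (xs l₁)) := by
    have := hcont.tendsto
    rwa [hfix] at this
  exact tendsto_fixedPoint_of_tendsto_apply hφ hT hfix hpt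

/-! ## §7.4 Sequences of operators and fixed points: Theorems 7.9–7.12 -/

/-- **Theorem 7.9** (Nadler).  If `T_n → T` uniformly, `T` is an `a`-contraction (`a ∈ [0, 1)`)
with fixed point `x*` and `x_n*` is a fixed point of `T_n`, then `x_n* → x*`.
[cite: Berinde2007, Ch. 7 §7.4 Thm 7.9] -/
theorem tendsto_fixedPoint_of_tendstoUniformly {T : X → X} {Tn : ℕ → X → X} {a : ℝ}
    (ha1 : a < 1) (hT : IsPhiContraction T fun t => a * t) {xs : X} (hxs : T xs = xs)
    {xn : ℕ → X} (hxn : ∀ n, Tn n (xn n) = xn n) (hunif : TendstoUniformly Tn T atTop) :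
    Tendsto xn atTop (𝓝 xs) := by
  rw [Metric.tendsto_atTop]
  intro ε hε
  have h1 : 0 < 1 - a := sub_pos.2 ha1
  obtain ⟨N, hN⟩ := eventually_atTop.1
    ((Metric.tendstoUniformly_iff.1 hunif) (ε * (1 - a)) (mul_pos hε h1))
  refine ⟨N, fun n hn => ?_⟩
  have hlt : dist (T (xn n)) (Tn n (xn n)) < ε * (1 - a) := hN n hn (xn n)
  have hle : dist (xn n) xs ≤ dist (Tn n (xn n)) (T (xn n)) + dist (T (xn n)) (T xs) := by
    calc dist (xn n) xs = dist (Tn n (xn n)) (T xs) := by rw [hxn, hxs]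
      _ ≤ _ := dist_triangle _ _ _
  have h3 : dist (T (xn n)) (T xs) ≤ a * dist (xn n) xs := hT _ _
  rw [dist_comm] at hlt
  have h4 : dist (xn n) xs * (1 - a) < ε * (1 - a) := by nlinarith
  exact lt_of_mul_lt_mul_right h4 h1.le

/-- Theorem 7.10, first part: a pointwise limit of `φ`-contractions is a `φ`-contraction.
[cite: Berinde2007, Ch. 7 §7.4 Thm 7.10] -/
theorem isPhiContraction_of_tendsto {T : X → X} {Tn : ℕ → X → X}
    (hTn : ∀ n, IsPhiContraction (Tn n) φ) (hpt : ∀ x, Tendsto (fun n => Tn n x) atTop (𝓝 (T x))) :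
    IsPhiContraction T φ := fun x y =>
  le_of_tendsto' ((hpt x).dist (hpt y)) fun n => hTn n x y

/-- The common core of Theorems 7.10 and 7.11 (deviation (b)): if the `T_n` are
`φ`-contractions with fixed points `x_n*`, `φ` strict, `T x* = x*` and `T_n x* → T x*`, then
`x_n* → x*`. [cite: Berinde2007, Ch. 7 §7.4 Thm 7.10 (proof, (14))] -/
theorem tendsto_fixedPoint_of_tendsto_at (hφ : IsStrictComparisonFunction φ)
    {T : X → X} {Tn : ℕ → X → X} (hTn : ∀ n, IsPhiContraction (Tn n) φ) {xs : X}
    (hxs : T xs = xs) {xn : ℕ → X} (hxn : ∀ n, Tn n (xn n) = xn n)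
    (hpt : Tendsto (fun n => Tn n xs) atTop (𝓝 (T xs))) : Tendsto xn atTop (𝓝 xs) := by
  rw [hxs] at hpt
  exact tendsto_fixedPoint_of_tendsto_apply hφ hTn hxn hpt

/-- **Theorem 7.10** (Rus; deviation (b)).  If the `T_n` are `φ`-contractions, `φ` a strict
comparison function, `T_n → T` pointwise, `T_n x_n* = x_n*` and `T x* = x*`, then `x_n* → x*`
(and `T` is a `φ`-contraction, `isPhiContraction_of_tendsto`).
[cite: Berinde2007, Ch. 7 §7.4 Thm 7.10] -/
theorem tendsto_fixedPoint_of_tendsto (hφ : IsStrictComparisonFunction φ)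
    {T : X → X} {Tn : ℕ → X → X} (hTn : ∀ n, IsPhiContraction (Tn n) φ) {xs : X}
    (hxs : T xs = xs) {xn : ℕ → X} (hxn : ∀ n, Tn n (xn n) = xn n)
    (hpt : ∀ x, Tendsto (fun n => Tn n x) atTop (𝓝 (T x))) : Tendsto xn atTop (𝓝 xs) :=
  tendsto_fixedPoint_of_tendsto_at hφ hTn hxs hxn (hpt xs)

/-- Theorem 7.10 on a complete space, with the fixed points produced by Theorem 2.7: the fixed
points `x_n*` of the `T_n` converge to the (unique) fixed point `x*` of the pointwise limit `T`.
[cite: Berinde2007, Ch. 7 §7.4 Thm 7.10] -/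
theorem exists_fixedPoint_tendsto_fixedPoint [CompleteSpace X] [Nonempty X]
    (hφ : IsStrictComparisonFunction φ) {T : X → X} {Tn : ℕ → X → X}
    (hTn : ∀ n, IsPhiContraction (Tn n) φ) (hpt : ∀ x, Tendsto (fun n => Tn n x) atTop (𝓝 (T x))) :
    ∃ (xs : X) (xn : ℕ → X), T xs = xs ∧ (∀ n, Tn n (xn n) = xn n) ∧
      Tendsto xn atTop (𝓝 xs) := by
  have hT : IsPhiContraction T φ := isPhiContraction_of_tendsto hTn hpt
  obtain ⟨xs, hxs, -⟩ := hT.existsUnique_fixedPoint hφ.toIsComparisonFunction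
  have hxn : ∀ n, ∃ x, Tn n x = x := fun n =>
    ((hTn n).existsUnique_fixedPoint hφ.toIsComparisonFunction).exists
  choose xn hxn using hxn
  exact ⟨xs, xn, hxs, hxn, tendsto_fixedPoint_of_tendsto hφ hTn hxs hxn hpt⟩

/-- **Theorem 7.11** (Rus; deviation (b)).  If the `T_n` are `φ`-contractions, `φ` strict,
converging uniformly to `T`, `T_n x_n* = x_n*` and `T x* = x*`, then `x_n* → x*`.
[cite: Berinde2007, Ch. 7 §7.4 Thm 7.11] -/
theorem tendsto_fixedPoint_of_tendstoUniformly' (hφ : IsStrictComparisonFunction φ)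
    {T : X → X} {Tn : ℕ → X → X} (hTn : ∀ n, IsPhiContraction (Tn n) φ)
    {xs : X} (hxs : T xs = xs) {xn : ℕ → X} (hxn : ∀ n, Tn n (xn n) = xn n)
    (hunif : TendstoUniformly Tn T atTop) : Tendsto xn atTop (𝓝 xs) :=
  tendsto_fixedPoint_of_tendsto_at hφ hTn hxs hxn (hunif.tendsto_at xs)

/-- **Theorem 7.12** (Rus; Nadler [Nad69, Thm. 2]; deviation (d)).  Let `T_n` be `φ_n`-contractions
and `T` a `φ`-contraction (`φ_n, φ` comparison functions) with `T_n → T` pointwise, `T x* = x*`,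
`T_n x_n* = x_n*`, and suppose some closed ball `B̄(x*, r)`, `r > 0`, is compact.  Then
`x_n* → x*`. [cite: Berinde2007, Ch. 7 §7.4 Thm 7.12] -/
theorem tendsto_fixedPoint_of_isCompact_closedBall {φn : ℕ → ℝ → ℝ}
    (hφ : IsComparisonFunction φ) (hφn : ∀ n, IsComparisonFunction (φn n))
    {T : X → X} {Tn : ℕ → X → X} (hT : IsPhiContraction T φ)
    (hTn : ∀ n, IsPhiContraction (Tn n) (φn n)) {xs : X} (hxs : T xs = xs) {r : ℝ} (hr : 0 < r)
    (hK : IsCompact (closedBall xs r)) {xn : ℕ → X} (hxn : ∀ n, Tn n (xn n) = xn n)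
    (hpt : ∀ x, Tendsto (fun n => Tn n x) atTop (𝓝 (T x))) : Tendsto xn atTop (𝓝 xs) := by
  rw [Metric.tendsto_atTop]
  intro ε hε
  -- work in the compact ball `K = B̄(x*, ε')`, `ε' = min (ε/2) r`
  set ε' := min (ε / 2) r with hε'
  have hε'0 : 0 < ε' := lt_min (half_pos hε) hr
  have hK' : IsCompact (closedBall xs ε') :=
    hK.of_isClosed_subset isClosed_closedBall (closedBall_subset_closedBall (min_le_right _ _))
  set δ := ε' - φ ε' with hδ
  have hδ0 : 0 < δ := hφ.sub_self_pos hε'0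
  -- pointwise convergence of nonexpansive maps is uniform on the compact `K` (finite `δ/3`-net)
  obtain ⟨t, htfin, hcover⟩ :=
    Metric.totallyBounded_iff.1 hK'.totallyBounded (δ / 3) (by positivity)
  have hev : ∀ᶠ n in atTop, ∀ y ∈ t, dist (Tn n y) (T y) < δ / 3 :=
    htfin.eventually_all.2 fun y _ => (Metric.tendsto_nhds.1 (hpt y)) _ (by positivity)
  obtain ⟨N, hN⟩ := eventually_atTop.1 hev
  refine ⟨N, fun n hn => ?_⟩
  have hU : ∀ x ∈ closedBall xs ε', dist (Tn n x) (T x) < δ := by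
    intro x hx
    obtain ⟨y, hy, hxy⟩ : ∃ y ∈ t, dist x y < δ / 3 := by
      simpa [mem_iUnion₂, mem_ball] using hcover hx
    have h1 : dist (Tn n x) (Tn n y) ≤ dist x y := (hTn n).dist_le (hφn n) x y
    have h2 : dist (Tn n y) (T y) < δ / 3 := hN n hn y hy
    have h3 : dist (T y) (T x) ≤ dist y x := hT.dist_le hφ y x
    rw [dist_comm y x] at h3
    linarith [dist_triangle4 (Tn n x) (Tn n y) (T y) (T x)]
  -- `T_n` maps `K` into itself
  have hM : MapsTo (Tn n) (closedBall xs ε') (closedBall xs ε') := by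
    intro x hx
    rw [mem_closedBall] at hx ⊢
    calc dist (Tn n x) xs = dist (Tn n x) (T xs) := by rw [hxs]
      _ ≤ dist (Tn n x) (T x) + dist (T x) (T xs) := dist_triangle _ _ _
      _ ≤ δ + φ ε' := add_le_add (hU x (mem_closedBall.2 hx)).le ((hT x xs).trans (hφ.mono hx))
      _ = ε' := by rw [hδ]; ring
  -- the restriction of `T_n` to the compact `K` is contractive, so it has a fixed point in `K`
  -- (Theorem 2.2), which is `x_n*` by uniqueness
  haveI : CompactSpace (closedBall xs ε') := isCompact_iff_compactSpace.1 hK'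
  haveI : Nonempty (closedBall xs ε') := ⟨⟨xs, mem_closedBall_self hε'0.le⟩⟩
  have hcontr : IsContractive (hM.restrict (Tn n) (closedBall xs ε') (closedBall xs ε')) := by
    intro u v huv
    have huv' : (u : X) ≠ v := fun h => huv (Subtype.ext h)
    have := (hTn n).isContractive (hφn n) u v huv'
    simpa [Subtype.dist_eq, MapsTo.val_restrict_apply] using this
  obtain ⟨z, hz, -⟩ := hcontr.existsUnique_fixedPoint_of_compactSpace
  have hz' : Tn n (z : X) = z := by
    have := congrArg Subtype.val hz
    simpa [MapsTo.val_restrict_apply] using this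
  have hzx : (z : X) = xn n := (hTn n).fixedPoint_unique (hφn n) hz' (hxn n)
  have hmem : xn n ∈ closedBall xs ε' := hzx ▸ z.2
  rw [mem_closedBall] at hmem
  calc dist (xn n) xs ≤ ε' := hmem
    _ ≤ ε / 2 := min_le_left _ _
    _ < ε := half_lt_self hε

/-- Theorem 7.12 as printed: on a locally compact metric space, fixed points of
`φ_n`-contractions converging pointwise to a `φ`-contraction converge to its fixed point.
[cite: Berinde2007, Ch. 7 §7.4 Thm 7.12] -/
theorem tendsto_fixedPoint_of_locallyCompact [LocallyCompactSpace X] {φn : ℕ → ℝ → ℝ}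
    (hφ : IsComparisonFunction φ) (hφn : ∀ n, IsComparisonFunction (φn n))
    {T : X → X} {Tn : ℕ → X → X} (hT : IsPhiContraction T φ)
    (hTn : ∀ n, IsPhiContraction (Tn n) (φn n)) {xs : X} (hxs : T xs = xs)
    {xn : ℕ → X} (hxn : ∀ n, Tn n (xn n) = xn n)
    (hpt : ∀ x, Tendsto (fun n => Tn n x) atTop (𝓝 (T x))) : Tendsto xn atTop (𝓝 xs) := by
  obtain ⟨r, hr, hK⟩ := exists_isCompact_closedBall xs
  exact tendsto_fixedPoint_of_isCompact_closedBall hφ hφn hT hTn hxs hr hK hxn hpt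

end SingleValued

/-! ## §7.3, multivalued operators: Lemmas 7.2–7.3, Definitions 7.5–7.8, Theorem 7.8,
Example 7.5 1) (Nadler), Corollary 7.1 (Lim) -/

section MultiValued

/-- **Lemma 7.2** (for `0 < H(A, B) < ∞`, deviation (e)): for `a ∈ A` and `q > 1` there is
`b ∈ B` with `d(a, b) < q H(A, B)`. [cite: Berinde2007, Ch. 7 §7.3 Lemma 7.2] -/
theorem exists_edist_lt_mul_hausdorffEDist {s t : Set X} {x : X} (hx : x ∈ s) {q : ℝ}
    (hq : 1 < q) (h0 : hausdorffEDist s t ≠ 0) (htop : hausdorffEDist s t ≠ ⊤) :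
    ∃ y ∈ t, edist x y < ENNReal.ofReal q * hausdorffEDist s t := by
  refine exists_edist_lt_of_hausdorffEDist_lt hx ?_
  calc hausdorffEDist s t = 1 * hausdorffEDist s t := (one_mul _).symm
    _ < ENNReal.ofReal q * hausdorffEDist s t :=
        ENNReal.mul_lt_mul_left h0 htop (ENNReal.one_lt_ofReal.2 hq)

/-- Lemma 7.2 in the `ε`-form actually used (Mathlib's
`Metric.exists_edist_lt_of_hausdorffEDist_lt`, restated with real distances): if `H(A, B) < r`
then every `a ∈ A` has some `b ∈ B` with
`d(a, b) < r`. [cite: Berinde2007, Ch. 7 §7.3 Lemma 7.2] -/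
theorem exists_dist_lt_of_hausdorffEDist_lt {s t : Set X} {x : X} (hx : x ∈ s) {r : ℝ}
    (h : hausdorffEDist s t < ENNReal.ofReal r) : ∃ y ∈ t, dist x y < r := by
  obtain ⟨y, hy, hxy⟩ := exists_edist_lt_of_hausdorffEDist_lt hx h
  exact ⟨y, hy, edist_lt_ofReal.1 hxy⟩

/-- **Lemma 7.3**: if every point of `A` is within `η` of `B` and vice versa, then `H(A, B) ≤ η`
(Mathlib's `Metric.hausdorffEDist_le_of_mem_edist`, with real distances).
[cite: Berinde2007, Ch. 7 §7.3 Lemma 7.3] -/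
theorem hausdorffEDist_le_of_forall_exists {s t : Set X} {η : ℝ}
    (h₁ : ∀ a ∈ s, ∃ b ∈ t, dist a b ≤ η) (h₂ : ∀ b ∈ t, ∃ a ∈ s, dist b a ≤ η) :
    hausdorffEDist s t ≤ ENNReal.ofReal η := by
  refine hausdorffEDist_le_of_mem_edist ?_ ?_
  · intro a ha
    obtain ⟨b, hb, hab⟩ := h₁ a ha
    exact ⟨b, hb, by rw [edist_dist]; exact ENNReal.ofReal_le_ofReal hab⟩
  · intro b hb
    obtain ⟨a, ha, hba⟩ := h₂ b hb
    exact ⟨a, ha, by rw [edist_dist]; exact ENNReal.ofReal_le_ofReal hba⟩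

/-- Definition 7.5: the fixed point set `Fix(T) = {x : x ∈ T x}` of a multivalued operator
`T : X → 𝒫(X)`. [cite: Berinde2007, Ch. 7 §7.3 Def 7.5] -/
def mFix {Y : Type*} (T : Y → Set Y) : Set Y := {x | x ∈ T x}

/-- [cite: Berinde2007, Ch. 7 §7.3 Def 7.5] -/
theorem mem_mFix {Y : Type*} {T : Y → Set Y} {x : Y} : x ∈ mFix T ↔ x ∈ T x := Iff.rfl

/-- Definition 7.6: `(x_n)` is a sequence of successive approximations of `T` starting from
`(x, y) ∈ Graph(T)`: `x₀ = x`, `x₁ = y`, `x_{n+1} ∈ T x_n`.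
[cite: Berinde2007, Ch. 7 §7.3 Def 7.6] -/
structure IsSuccApprox {Y : Type*} (T : Y → Set Y) (x y : Y) (u : ℕ → Y) : Prop where
  zero : u 0 = x
  one : u 1 = y
  succ_mem : ∀ n, u (n + 1) ∈ T (u n)

/-- Definition 7.6: `T` is a *multivalued weakly Picard (MWP) operator* if from every
`(x, y) ∈ Graph(T)` some sequence of successive approximations converges to a fixed point of `T`.
[cite: Berinde2007, Ch. 7 §7.3 Def 7.6] -/
def IsMWPicard (T : X → Set X) : Prop :=
  ∀ x, ∀ y ∈ T x, ∃ u : ℕ → X, IsSuccApprox T x y u ∧ ∃ z ∈ mFix T, Tendsto u atTop (𝓝 z)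

/-- Definition 7.7: `T^∞(x, y)` = the fixed points reachable as limits of successive
approximations starting from `(x, y)`. [cite: Berinde2007, Ch. 7 §7.3 Def 7.7] -/
def Tinf (T : X → Set X) (x y : X) : Set X :=
  {z | z ∈ mFix T ∧ ∃ u : ℕ → X, IsSuccApprox T x y u ∧ Tendsto u atTop (𝓝 z)}

/-- Definition 7.8: `T` is a *`c`-multivalued weakly Picard operator*: an MWP operator with
`D(x, T^∞(x, y)) ≤ c d(x, y)` for all `(x, y) ∈ Graph(T)`.
[cite: Berinde2007, Ch. 7 §7.3 Def 7.8] -/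
def IsCMWPicard (c : ℝ) (T : X → Set X) : Prop :=
  IsMWPicard T ∧ ∀ x, ∀ y ∈ T x, infDist x (Tinf T x y) ≤ c * dist x y

/-- The metric content of Definition 7.8 used in the proof of Theorem 7.8 (deviation (e)): for
`y ∈ T x` and `ε > 0` there is a fixed point `z` of `T` with `d(x, z) ≤ c d(x, y) + ε`.
[cite: Berinde2007, Ch. 7 §7.3 Def 7.8, Thm 7.8 (proof)] -/
def FixedPointsNear (c : ℝ) (T : X → Set X) : Prop :=
  ∀ x, ∀ y ∈ T x, ∀ ε > 0, ∃ z ∈ mFix T, dist x z ≤ c * dist x y + ε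

/-- A `c`-MWP operator has fixed points near every point of its graph in the sense of
`FixedPointsNear` (the step "choose `u*_η ∈ T₁^∞(x₂*, t_η)`" of the proof of Theorem 7.8).
[cite: Berinde2007, Ch. 7 §7.3 Def 7.8, Thm 7.8 (proof)] -/
theorem IsCMWPicard.fixedPointsNear {c : ℝ} {T : X → Set X} (h : IsCMWPicard c T) :
    FixedPointsNear c T := by
  intro x y hy ε hε
  obtain ⟨u, hu, z₀, hz₀, hlim⟩ := h.1 x y hy
  have hne : (Tinf T x y).Nonempty := ⟨z₀, hz₀, u, hu, hlim⟩
  have hlt : infDist x (Tinf T x y) < c * dist x y + ε :=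
    lt_of_le_of_lt (h.2 x y hy) (lt_add_of_pos_right _ hε)
  obtain ⟨z, hz, hdz⟩ := (infDist_lt_iff hne).1 hlt
  exact ⟨z, hz.1, hdz.le⟩

/-- One half of Theorem 7.8: if `x ∈ A`, `H(A, T x) ≤ η` and `T` has fixed points near its graph
with constant `c ≥ 0`, then `D(x, Fix T) ≤ c η`. [cite: Berinde2007, Ch. 7 §7.3 Thm 7.8 (proof)] -/
theorem infEDist_mFix_le {c : ℝ} (hc : 0 ≤ c) {T : X → Set X} (hT : FixedPointsNear c T)
    {x : X} {s : Set X} (hxs : x ∈ s) {η : ℝ} (hη0 : 0 ≤ η)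
    (hη : hausdorffEDist s (T x) ≤ ENNReal.ofReal η) :
    infEDist x (mFix T) ≤ ENNReal.ofReal (c * η) := by
  -- for every `δ > 0`: some `y ∈ T x` with `d(x, y) < η + δ`, then a fixed point `z` with
  -- `d(x, z) ≤ c (η + δ) + δ`
  have key : ∀ δ : ℝ, 0 < δ → infEDist x (mFix T) ≤ ENNReal.ofReal (c * η + (c + 1) * δ) := by
    intro δ hδ
    have hlt : hausdorffEDist s (T x) < ENNReal.ofReal (η + δ) :=
      hη.trans_lt ((ENNReal.ofReal_lt_ofReal_iff (by linarith)).2 (by linarith))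
    obtain ⟨y, hy, hxy⟩ := exists_dist_lt_of_hausdorffEDist_lt hxs hlt
    obtain ⟨z, hz, hxz⟩ := hT x y hy δ hδ
    calc infEDist x (mFix T) ≤ edist x z := infEDist_le_edist_of_mem hz
      _ = ENNReal.ofReal (dist x z) := edist_dist x z
      _ ≤ ENNReal.ofReal (c * η + (c + 1) * δ) := by
          refine ENNReal.ofReal_le_ofReal ?_
          have : c * dist x y ≤ c * (η + δ) := mul_le_mul_of_nonneg_left hxy.le hc
          linarith
  refine ENNReal.le_of_forall_pos_le_add fun ε hε _ => ?_
  have h := key (ε / (c + 1)) (by positivity)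
  have hcε : (c + 1) * ((ε : ℝ) / (c + 1)) = ε := by field_simp
  rw [hcε, ENNReal.ofReal_add (by positivity) (by positivity), ENNReal.ofReal_coe_nnreal] at h
  exact h

/-- **Theorem 7.8** (Rus–Petruşel–Sîntămărian; deviation (e)).  If `T_i` has fixed points near its
graph with constant `c_i ≥ 0` (`i = 1, 2`; in particular if `T_i` is a `c_i`-MWP operator) and
`H(T₁ x, T₂ x) ≤ η` for all `x`, then `H(Fix T₁, Fix T₂) ≤ η max {c₁, c₂}`.
[cite: Berinde2007, Ch. 7 §7.3 Thm 7.8] -/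
theorem hausdorffEDist_mFix_le {T₁ T₂ : X → Set X} {c₁ c₂ : ℝ} (hc₁ : 0 ≤ c₁) (hc₂ : 0 ≤ c₂)
    (h₁ : FixedPointsNear c₁ T₁) (h₂ : FixedPointsNear c₂ T₂) {η : ℝ} (hη0 : 0 ≤ η)
    (hη : ∀ x, hausdorffEDist (T₁ x) (T₂ x) ≤ ENNReal.ofReal η) :
    hausdorffEDist (mFix T₁) (mFix T₂) ≤ ENNReal.ofReal (η * max c₁ c₂) := by
  refine hausdorffEDist_le_of_infEDist ?_ ?_
  · intro x hx
    refine (infEDist_mFix_le hc₂ h₂ (s := T₁ x) (mem_mFix.1 hx) hη0 (hη x)).trans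
      (ENNReal.ofReal_le_ofReal ?_)
    rw [mul_comm]
    exact mul_le_mul_of_nonneg_left (le_max_right _ _) hη0
  · intro x hx
    have hη' : hausdorffEDist (T₂ x) (T₁ x) ≤ ENNReal.ofReal η := by
      rw [hausdorffEDist_comm]; exact hη x
    refine (infEDist_mFix_le hc₁ h₁ (s := T₂ x) (mem_mFix.1 hx) hη0 hη').trans
      (ENNReal.ofReal_le_ofReal ?_)
    rw [mul_comm]
    exact mul_le_mul_of_nonneg_left (le_max_left _ _) hη0

/-- Theorem 7.8 in the book's form, for `c_i`-multivalued weakly Picard operators.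
[cite: Berinde2007, Ch. 7 §7.3 Thm 7.8] -/
theorem hausdorffEDist_mFix_le_of_isCMWPicard {T₁ T₂ : X → Set X} {c₁ c₂ : ℝ} (hc₁ : 0 ≤ c₁)
    (hc₂ : 0 ≤ c₂) (h₁ : IsCMWPicard c₁ T₁) (h₂ : IsCMWPicard c₂ T₂) {η : ℝ} (hη0 : 0 ≤ η)
    (hη : ∀ x, hausdorffEDist (T₁ x) (T₂ x) ≤ ENNReal.ofReal η) :
    hausdorffEDist (mFix T₁) (mFix T₂) ≤ ENNReal.ofReal (η * max c₁ c₂) :=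
  hausdorffEDist_mFix_le hc₁ hc₂ h₁.fixedPointsNear h₂.fixedPointsNear hη0 hη

/-! ### Example 7.5 1): multivalued contractions (Nadler) -/

/-- A *multivalued `a`-contraction*: `H(T x, T y) ≤ a d(x, y)` (Example 7.5 1)).
[cite: Berinde2007, Ch. 7 §7.3 Example 7.5 1)] -/
def IsMContraction (a : ℝ) (T : X → Set X) : Prop :=
  ∀ x y, hausdorffEDist (T x) (T y) ≤ ENNReal.ofReal (a * dist x y)

namespace IsMContraction

variable {a : ℝ} {T : X → Set X}

/-- The selection step of Nadler's construction: for `v ∈ T u` and `δ > 0` there is `w ∈ T v`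
with `d(v, w) < a d(u, v) + δ` (Lemma 7.2). [cite: Berinde2007, Ch. 7 §7.3 Lemma 7.2,
Example 7.5 1)] -/
theorem exists_mem_dist_lt (hT : IsMContraction a T) (ha : 0 ≤ a) {u v : X} (hv : v ∈ T u)
    {δ : ℝ} (hδ : 0 < δ) : ∃ w ∈ T v, dist v w < a * dist u v + δ := by
  have hlt : hausdorffEDist (T u) (T v) < ENNReal.ofReal (a * dist u v + δ) :=
    (hT u v).trans_lt ((ENNReal.ofReal_lt_ofReal_iff (by positivity)).2 (by linarith))
  exact exists_dist_lt_of_hausdorffEDist_lt hv hlt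

/-- Nadler's chain of consecutive pairs `(x_n, x_{n+1}) ∈ Graph(T)` with
`d(x_{n+1}, x_{n+2}) < a d(x_n, x_{n+1}) + e_n`. [cite: Berinde2007, Ch. 7 §7.3 Example 7.5 1)] -/
noncomputable def chain (hT : IsMContraction a T) (ha : 0 ≤ a) (e : ℕ → ℝ) (he : ∀ n, 0 < e n)
    {x y : X} (hy : y ∈ T x) : ℕ → {p : X × X // p.2 ∈ T p.1}
  | 0 => ⟨(x, y), hy⟩
  | n + 1 =>
    ⟨((chain hT ha e he hy n).1.2,
        Classical.choose (hT.exists_mem_dist_lt ha (chain hT ha e he hy n).2 (he n))),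
      (Classical.choose_spec (hT.exists_mem_dist_lt ha (chain hT ha e he hy n).2 (he n))).1⟩

/-- Consecutive pairs of the chain overlap. [cite: Berinde2007, Ch. 7 §7.3 Example 7.5 1)] -/
theorem chain_succ_fst (hT : IsMContraction a T) (ha : 0 ≤ a) (e : ℕ → ℝ) (he : ∀ n, 0 < e n)
    {x y : X} (hy : y ∈ T x) (n : ℕ) :
    (chain hT ha e he hy (n + 1)).1.1 = (chain hT ha e he hy n).1.2 := rfl

/-- The selection inequality along the chain. [cite: Berinde2007, Ch. 7 §7.3 Example 7.5 1)] -/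
theorem chain_dist_lt (hT : IsMContraction a T) (ha : 0 ≤ a) (e : ℕ → ℝ) (he : ∀ n, 0 < e n)
    {x y : X} (hy : y ∈ T x) (n : ℕ) :
    dist (chain hT ha e he hy (n + 1)).1.1 (chain hT ha e he hy (n + 1)).1.2 <
      a * dist (chain hT ha e he hy n).1.1 (chain hT ha e he hy n).1.2 + e n :=
  (Classical.choose_spec (hT.exists_mem_dist_lt ha (chain hT ha e he hy n).2 (he n))).2

/-- The sequence of successive approximations `x_n` extracted from the chain.
[cite: Berinde2007, Ch. 7 §7.3 Example 7.5 1)] -/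
noncomputable def cseq (hT : IsMContraction a T) (ha : 0 ≤ a) (e : ℕ → ℝ) (he : ∀ n, 0 < e n)
    {x y : X} (hy : y ∈ T x) (n : ℕ) : X :=
  (chain hT ha e he hy n).1.1

/-- `cseq` is a sequence of successive approximations from `(x, y)` (Definition 7.6).
[cite: Berinde2007, Ch. 7 §7.3 Def 7.6, Example 7.5 1)] -/
theorem cseq_isSuccApprox (hT : IsMContraction a T) (ha : 0 ≤ a) (e : ℕ → ℝ)
    (he : ∀ n, 0 < e n) {x y : X} (hy : y ∈ T x) : IsSuccApprox T x y (cseq hT ha e he hy) where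
  zero := rfl
  one := rfl
  succ_mem n := by
    show (chain hT ha e he hy (n + 1)).1.1 ∈ T (chain hT ha e he hy n).1.1
    rw [chain_succ_fst]
    exact (chain hT ha e he hy n).2

/-- `d(x_{n+1}, x_{n+2}) < a d(x_n, x_{n+1}) + e_n` along `cseq`.
[cite: Berinde2007, Ch. 7 §7.3 Example 7.5 1)] -/
theorem dist_cseq_succ_lt (hT : IsMContraction a T) (ha : 0 ≤ a) (e : ℕ → ℝ) (he : ∀ n, 0 < e n)
    {x y : X} (hy : y ∈ T x) (n : ℕ) :
    dist (cseq hT ha e he hy (n + 1)) (cseq hT ha e he hy (n + 2)) <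
      a * dist (cseq hT ha e he hy n) (cseq hT ha e he hy (n + 1)) + e n := by
  have h := chain_dist_lt hT ha e he hy n
  rw [← chain_succ_fst hT ha e he hy n, ← chain_succ_fst hT ha e he hy (n + 1)] at h
  exact h

/-- **Example 7.5 1)** (Nadler's fixed point theorem with Lim's estimate; deviation (e)).  A
multivalued `a`-contraction (`a ∈ [0, 1)`) with closed values on a complete metric space: from
every `(x, y) ∈ Graph(T)` and for every `ε > 0` there is a sequence of successive approximations
converging to a fixed point `z` with `d(x, z) ≤ d(x, y) / (1 - a) + ε`.
[cite: Berinde2007, Ch. 7 §7.3 Example 7.5 1)] -/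
theorem exists_succApprox (hT : IsMContraction a T) (ha0 : 0 ≤ a) (ha1 : a < 1) [CompleteSpace X]
    (hcl : ∀ x, IsClosed (T x)) {x y : X} (hy : y ∈ T x) {ε : ℝ} (hε : 0 < ε) :
    ∃ u : ℕ → X, IsSuccApprox T x y u ∧ ∃ z ∈ mFix T, Tendsto u atTop (𝓝 z) ∧
      dist x z ≤ dist x y / (1 - a) + ε := by
  have h1a : 0 < 1 - a := sub_pos.2 ha1
  -- errors `e_n = (ε (1 - a) / 2) (1/2)ⁿ`, `∑ e_n ≤ ε (1 - a)`
  set e : ℕ → ℝ := fun n => ε * (1 - a) / 2 * (1 / 2) ^ n with he_def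
  have he : ∀ n, 0 < e n := fun n => by positivity
  have hE : ∀ N, ∑ i ∈ Finset.range N, e i ≤ ε * (1 - a) := by
    intro N
    rw [← Finset.mul_sum]
    have := sum_geometric_two_le N
    have h0 : 0 ≤ ε * (1 - a) / 2 := by positivity
    nlinarith
  set u := cseq hT ha0 e he hy with hu_def
  have hsa : IsSuccApprox T x y u := cseq_isSuccApprox hT ha0 e he hy
  set d : ℕ → ℝ := fun n => dist (u n) (u (n + 1)) with hd_def
  have hd0 : ∀ n, 0 ≤ d n := fun n => dist_nonneg
  have hdrec : ∀ n, d (n + 1) ≤ a * d n + e n := fun n => (dist_cseq_succ_lt hT ha0 e he hy n).le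
  -- partial sums: `S ≤ a S + ∑ e + d₀`, so `S ≤ (d₀ + ε (1 - a)) / (1 - a)`
  set C := (dist x y + ε * (1 - a)) / (1 - a) with hC
  have hdxy : d 0 = dist x y := by
    show dist (u 0) (u 1) = dist x y
    rw [hsa.zero, hsa.one]
  have hS : ∀ N, ∑ i ∈ Finset.range N, d i ≤ C := by
    intro N
    cases N with
    | zero =>
      simp only [Finset.range_zero, Finset.sum_empty]
      positivity
    | succ N =>
      have hsplit : ∑ i ∈ Finset.range (N + 1), d i = (∑ i ∈ Finset.range N, d (i + 1)) + d 0 :=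
        Finset.sum_range_succ' _ _
      have hrec : (∑ i ∈ Finset.range N, d (i + 1)) ≤
          a * ∑ i ∈ Finset.range N, d i + ∑ i ∈ Finset.range N, e i := by
        rw [Finset.mul_sum, ← Finset.sum_add_distrib]
        exact Finset.sum_le_sum fun i _ => hdrec i
      have hmono : (∑ i ∈ Finset.range N, d i) ≤ ∑ i ∈ Finset.range (N + 1), d i := by
        rw [Finset.sum_range_succ]
        linarith [hd0 N]
      have hs : (∑ i ∈ Finset.range (N + 1), d i) * (1 - a) ≤ dist x y + ε * (1 - a) := by
        have := hE N
        nlinarith [mul_le_mul_of_nonneg_left hmono ha0]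
      rw [hC, le_div_iff₀ h1a]
      exact hs
  have hsum : Summable d := summable_of_sum_range_le hd0 hS
  have hcauchy : CauchySeq u := cauchySeq_of_summable_dist hsum
  obtain ⟨z, hz⟩ := cauchySeq_tendsto_of_complete hcauchy
  -- the limit is a fixed point (closed values)
  have hzfix : z ∈ mFix T := by
    rw [mem_mFix, mem_iff_infEDist_zero_of_closed (hcl z)]
    refine le_antisymm ?_ bot_le
    have hr : Tendsto (fun n => ENNReal.ofReal (dist z (u (n + 1)) + a * dist (u n) z)) atTop
        (𝓝 (ENNReal.ofReal 0)) := by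
      refine ENNReal.tendsto_ofReal ?_
      have h1 : Tendsto (fun n => dist z (u (n + 1))) atTop (𝓝 (dist z z)) :=
        tendsto_const_nhds.dist (hz.comp (tendsto_add_atTop_nat 1))
      have h2 : Tendsto (fun n => a * dist (u n) z) atTop (𝓝 (a * dist z z)) :=
        (hz.dist tendsto_const_nhds).const_mul a
      rw [dist_self] at h1
      rw [dist_self, mul_zero] at h2
      simpa using h1.add h2
    rw [ENNReal.ofReal_zero] at hr
    refine ge_of_tendsto' hr fun n => ?_
    calc infEDist z (T z) ≤ infEDist z (T (u n)) + hausdorffEDist (T (u n)) (T z) :=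
          infEDist_le_infEDist_add_hausdorffEDist
      _ ≤ edist z (u (n + 1)) + ENNReal.ofReal (a * dist (u n) z) :=
          add_le_add (infEDist_le_edist_of_mem (hsa.succ_mem n)) (hT (u n) z)
      _ = ENNReal.ofReal (dist z (u (n + 1)) + a * dist (u n) z) := by
          rw [edist_dist, ENNReal.ofReal_add dist_nonneg (by positivity)]
  refine ⟨u, hsa, z, hzfix, hz, ?_⟩
  -- `d(x, z) ≤ ∑ d_n ≤ C = d(x, y) / (1 - a) + ε`
  have h1 : dist (u 0) z ≤ ∑' n, d n := dist_le_tsum_dist_of_tendsto₀ hsum hz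
  have h2 : (∑' n, d n) ≤ C := Real.tsum_le_of_sum_range_le hd0 hS
  have h3 : C = dist x y / (1 - a) + ε := by
    rw [hC]
    field_simp
  rw [hsa.zero] at h1
  linarith

/-- Example 7.5 1), conclusion: a multivalued `a`-contraction with closed values on a complete
metric space has fixed points near its graph with constant `(1 - a)⁻¹`.
[cite: Berinde2007, Ch. 7 §7.3 Example 7.5 1)] -/
theorem fixedPointsNear (hT : IsMContraction a T) (ha0 : 0 ≤ a) (ha1 : a < 1) [CompleteSpace X]
    (hcl : ∀ x, IsClosed (T x)) : FixedPointsNear (1 - a)⁻¹ T := by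
  intro x y hy ε hε
  obtain ⟨u, -, z, hz, -, hdist⟩ := hT.exists_succApprox ha0 ha1 hcl hy hε
  exact ⟨z, hz, by rwa [← div_eq_inv_mul]⟩

/-- **Example 7.5 1)**: a multivalued `a`-contraction with closed values on a complete metric space
is a `(1 - a)⁻¹`-multivalued weakly Picard operator.
[cite: Berinde2007, Ch. 7 §7.3 Example 7.5 1)] -/
theorem isCMWPicard (hT : IsMContraction a T) (ha0 : 0 ≤ a) (ha1 : a < 1) [CompleteSpace X]
    (hcl : ∀ x, IsClosed (T x)) : IsCMWPicard (1 - a)⁻¹ T := by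
  refine ⟨fun x y hy => ?_, fun x y hy => ?_⟩
  · obtain ⟨u, hu, z, hz, hlim, -⟩ := hT.exists_succApprox ha0 ha1 hcl hy one_pos
    exact ⟨u, hu, z, hz, hlim⟩
  · refine le_of_forall_pos_le_add fun ε hε => ?_
    obtain ⟨u, hu, z, hz, hlim, hdist⟩ := hT.exists_succApprox ha0 ha1 hcl hy hε
    have hmem : z ∈ Tinf T x y := ⟨hz, u, hu, hlim⟩
    calc infDist x (Tinf T x y) ≤ dist x z := infDist_le_dist_of_mem hmem
      _ ≤ dist x y / (1 - a) + ε := hdist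
      _ = (1 - a)⁻¹ * dist x y + ε := by rw [div_eq_inv_mul]

end IsMContraction

/-- **Corollary 7.1** (Lim), `η`-form: for two multivalued `k`-contractions with closed values on a
complete space with `H(T₁ x, T₂ x) ≤ η` for all `x`, `H(Fix T₁, Fix T₂) ≤ (1 - k)⁻¹ η`.
[cite: Berinde2007, Ch. 7 §7.3 Cor 7.1] -/
theorem hausdorffEDist_mFix_le_of_isMContraction [CompleteSpace X] {T₁ T₂ : X → Set X} {k : ℝ}
    (hk0 : 0 ≤ k) (hk1 : k < 1) (h₁ : IsMContraction k T₁) (h₂ : IsMContraction k T₂)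
    (hcl₁ : ∀ x, IsClosed (T₁ x)) (hcl₂ : ∀ x, IsClosed (T₂ x)) {η : ℝ} (hη0 : 0 ≤ η)
    (hη : ∀ x, hausdorffEDist (T₁ x) (T₂ x) ≤ ENNReal.ofReal η) :
    hausdorffEDist (mFix T₁) (mFix T₂) ≤ ENNReal.ofReal ((1 - k)⁻¹ * η) := by
  have hc : 0 ≤ (1 - k)⁻¹ := inv_nonneg.2 (sub_nonneg.2 hk1.le)
  have h := hausdorffEDist_mFix_le hc hc (h₁.fixedPointsNear hk0 hk1 hcl₁)
    (h₂.fixedPointsNear hk0 hk1 hcl₂) hη0 hη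
  rwa [max_self, mul_comm] at h

/-- **Corollary 7.1** (Lim): `H(Fix T₁, Fix T₂) ≤ (1 - k)⁻¹ sup_x H(T₁ x, T₂ x)` for two
multivalued `k`-contractions with closed values on a complete metric space.
[cite: Berinde2007, Ch. 7 §7.3 Cor 7.1] -/
theorem hausdorffEDist_mFix_le_iSup [CompleteSpace X] {T₁ T₂ : X → Set X} {k : ℝ}
    (hk0 : 0 ≤ k) (hk1 : k < 1) (h₁ : IsMContraction k T₁) (h₂ : IsMContraction k T₂)
    (hcl₁ : ∀ x, IsClosed (T₁ x)) (hcl₂ : ∀ x, IsClosed (T₂ x)) :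
    hausdorffEDist (mFix T₁) (mFix T₂) ≤
      ENNReal.ofReal (1 - k)⁻¹ * ⨆ x, hausdorffEDist (T₁ x) (T₂ x) := by
  have hc0 : 0 < (1 - k)⁻¹ := inv_pos.2 (sub_pos.2 hk1)
  by_cases htop : (⨆ x, hausdorffEDist (T₁ x) (T₂ x)) = ⊤
  · rw [htop, ENNReal.mul_top (ENNReal.ofReal_pos.2 hc0).ne']
    exact le_top
  · set η := (⨆ x, hausdorffEDist (T₁ x) (T₂ x)).toReal with hη
    have hη' : ENNReal.ofReal η = ⨆ x, hausdorffEDist (T₁ x) (T₂ x) := ENNReal.ofReal_toReal htop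
    have hle : ∀ x, hausdorffEDist (T₁ x) (T₂ x) ≤ ENNReal.ofReal η := fun x => by
      rw [hη']; exact le_iSup (fun x => hausdorffEDist (T₁ x) (T₂ x)) x
    have h := hausdorffEDist_mFix_le_of_isMContraction hk0 hk1 h₁ h₂ hcl₁ hcl₂
      ENNReal.toReal_nonneg hle
    rwa [ENNReal.ofReal_mul hc0.le, hη'] at h

end MultiValued

end Literature.Analysis.Convex.FixedPointDataDependence
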